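import Mathlib
import Summits.CriticalPhenomena.Ising3DConformalLimit.Theorems.HyperoctahedralRPNullConeLocalRigidityFibre

/-!
# Null-cone local rigidity — hyperoctahedral invariants of degree 2 and 4

Helper file for item `stmt-CriticalPhenomena-4275`
(`Summit.CriticalPhenomena.Ising3DConformalLimit.Theses.HyperoctahedralRP.NullConeLocalRigidity`).

Elementary invariant theory of `B₃` (coordinate permutations and sign changes acting on
`ℝ[x₀, x₁, x₂]`) in degrees 2 and 4, done coefficient-wise:

* `quadratic_eq`: an invariant homogeneous quadratic is `A · (x·x)`;
* `quartic_eq`: an invariant homogeneous quartic is `A · Σ xᵢ⁴ + B · Σ_{i<j} xᵢ² xⱼ²`.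

A monomial of an even polynomial has even exponents (`coeff_eq_zero_of_odd`), a homogeneous
polynomial has only monomials of the right degree, and permutation invariance identifies the
coefficients inside an `S₃`-orbit (`coeff_mapDomain_perm`); so an invariant form with vanishing
coefficients at `x₀²` (resp. `x₀⁴`, `x₀²x₁²`) is zero (`quadratic_eq_zero`, `quartic_eq_zero`).
-/

noncomputable section

open MvPolynomial

namespace Summit.CriticalPhenomena.Ising3DConformalLimit.Theorems.NullConeLocalRigidity

/-! ### Exponent vectors on `Fin 3` -/

/-- An exponent vector on three variables is the sum of its three singles. -/
theorem finsupp_fin3_eq (d : Fin 3 →₀ ℕ) :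
    d = Finsupp.single 0 (d 0) + Finsupp.single 1 (d 1) + Finsupp.single 2 (d 2) := by
  ext i
  fin_cases i <;> simp

/-- Two exponent vectors on three variables agree iff their three values agree. -/
theorem finsupp_fin3_eq_iff {d d' : Fin 3 →₀ ℕ} :
    d = d' ↔ d 0 = d' 0 ∧ d 1 = d' 1 ∧ d 2 = d' 2 := by
  constructor
  · rintro rfl
    exact ⟨rfl, rfl, rfl⟩
  · rintro ⟨h0, h1, h2⟩
    rw [finsupp_fin3_eq d, finsupp_fin3_eq d', h0, h1, h2]

/-- Degree of an explicit exponent vector. -/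
theorem degree_fin3 (a b c : ℕ) :
    (Finsupp.single (0 : Fin 3) a + Finsupp.single 1 b + Finsupp.single 2 c).degree
      = a + b + c := by
  simp only [map_add, Finsupp.degree_single]

/-- Permutation invariance identifies coefficients along `S₃`-orbits. -/
theorem coeff_mapDomain_perm {Q : MvPolynomial (Fin 3) ℝ}
    (hsymm : ∀ σ : Equiv.Perm (Fin 3), rename σ Q = Q) (σ : Equiv.Perm (Fin 3))
    (d : Fin 3 →₀ ℕ) : coeff (Finsupp.mapDomain σ d) Q = coeff d Q := by
  conv_lhs => rw [← hsymm σ]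
  exact coeff_rename_mapDomain σ σ.injective Q d

/-! ### The quadratic form `x·x` -/

/-- `x·x` is homogeneous of degree 2. -/
theorem sumSq_isHomogeneous :
    ((X 0 : MvPolynomial (Fin 3) ℝ) ^ 2 + X 1 ^ 2 + X 2 ^ 2).IsHomogeneous 2 :=
  ((isHomogeneous_X_pow _ _).add (isHomogeneous_X_pow _ _)).add (isHomogeneous_X_pow _ _)

/-- `x·x` is permutation invariant. -/
theorem rename_sumSq (σ : Equiv.Perm (Fin 3)) :
    rename σ ((X 0 : MvPolynomial (Fin 3) ℝ) ^ 2 + X 1 ^ 2 + X 2 ^ 2)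
      = (X 0 : MvPolynomial (Fin 3) ℝ) ^ 2 + X 1 ^ 2 + X 2 ^ 2 := by
  have h : ((X 0 : MvPolynomial (Fin 3) ℝ) ^ 2 + X 1 ^ 2 + X 2 ^ 2) = ∑ i : Fin 3, X i ^ 2 := by
    simp [Fin.sum_univ_three]
  rw [h, map_sum]
  simp only [map_pow, rename_X]
  exact Equiv.sum_comp σ (fun i => (X i : MvPolynomial (Fin 3) ℝ) ^ 2)

/-- `x·x` is invariant under sign changes. -/
theorem aeval_neg_sumSq (i : Fin 3) :
    MvPolynomial.aeval (fun j : Fin 3 => if j = i then -(X j : MvPolynomial (Fin 3) ℝ) else X j)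
      ((X 0 : MvPolynomial (Fin 3) ℝ) ^ 2 + X 1 ^ 2 + X 2 ^ 2)
      = (X 0 : MvPolynomial (Fin 3) ℝ) ^ 2 + X 1 ^ 2 + X 2 ^ 2 := by
  have key : ∀ j : Fin 3,
      (if j = i then -(X j : MvPolynomial (Fin 3) ℝ) else X j) ^ 2 = X j ^ 2 := by
    intro j
    split_ifs <;> ring
  simp only [map_add, map_pow, MvPolynomial.aeval_X, key]

/-- `x·x ≠ 0`. -/
theorem sumSq_ne_zero : ((X 0 : MvPolynomial (Fin 3) ℝ) ^ 2 + X 1 ^ 2 + X 2 ^ 2) ≠ 0 := by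
  intro h
  have := congrArg (MvPolynomial.eval ![(1 : ℝ), 0, 0]) h
  simp at this

/-- The coefficient of `x₀²` in `x·x` is `1`. -/
theorem coeff_sumSq_single :
    coeff (Finsupp.single 0 2) ((X 0 : MvPolynomial (Fin 3) ℝ) ^ 2 + X 1 ^ 2 + X 2 ^ 2) = 1 := by
  simp only [coeff_add, coeff_X_pow, Finsupp.single_eq_single_iff]
  simp

/-! ### Invariant quadratics -/

/-- An invariant homogeneous quadratic with vanishing `x₀²`-coefficient is zero. -/
theorem quadratic_eq_zero (R : MvPolynomial (Fin 3) ℝ) (hhom : R.IsHomogeneous 2)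
    (hsymm : ∀ σ : Equiv.Perm (Fin 3), rename σ R = R)
    (heven : ∀ (i : Fin 3) (d : Fin 3 →₀ ℕ), Odd (d i) → coeff d R = 0)
    (h200 : coeff (Finsupp.single 0 2) R = 0) : R = 0 := by
  have h020 : coeff (Finsupp.single 1 2) R = 0 := by
    have := coeff_mapDomain_perm hsymm (Equiv.swap 0 1) (Finsupp.single 0 2)
    rw [Finsupp.mapDomain_single, Equiv.swap_apply_left] at this
    rw [this, h200]
  have h002 : coeff (Finsupp.single 2 2) R = 0 := by
    have := coeff_mapDomain_perm hsymm (Equiv.swap 0 2) (Finsupp.single 0 2)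
    rw [Finsupp.mapDomain_single, Equiv.swap_apply_left] at this
    rw [this, h200]
  ext d
  rw [coeff_zero]
  obtain ⟨a, b, c, rfl⟩ : ∃ a b c : ℕ,
      d = Finsupp.single 0 a + Finsupp.single 1 b + Finsupp.single 2 c :=
    ⟨d 0, d 1, d 2, finsupp_fin3_eq d⟩
  by_cases hdeg : a + b + c = 2
  · have ha : a ≤ 2 := by omega
    have hb : b ≤ 2 := by omega
    have hc : c ≤ 2 := by omega
    interval_cases a <;> interval_cases b <;> interval_cases c <;>
      (try simp only [Finsupp.single_zero, add_zero, zero_add]) <;>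
      first
        | (exfalso; omega)
        | assumption
        | (apply heven 0; simp only [Finsupp.coe_add, Pi.add_apply, Finsupp.single_apply]; decide)
        | (apply heven 1; simp only [Finsupp.coe_add, Pi.add_apply, Finsupp.single_apply]; decide)
  · exact hhom.coeff_eq_zero (by rw [degree_fin3]; exact hdeg)

/-- **Invariant quadratics.** A `B₃`-invariant homogeneous quadratic is `A · (x·x)`,
`A` its `x₀²`-coefficient. -/
theorem quadratic_eq (Q : MvPolynomial (Fin 3) ℝ) (hhom : Q.IsHomogeneous 2)
    (hsymm : ∀ σ : Equiv.Perm (Fin 3), rename σ Q = Q)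
    (heven : ∀ i : Fin 3, MvPolynomial.aeval
      (fun j : Fin 3 => if j = i then -(X j : MvPolynomial (Fin 3) ℝ) else X j) Q = Q) :
    Q = MvPolynomial.C (coeff (Finsupp.single 0 2) Q)
      * ((X 0 : MvPolynomial (Fin 3) ℝ) ^ 2 + X 1 ^ 2 + X 2 ^ 2) := by
  set A := coeff (Finsupp.single 0 2) Q with hA
  rw [← sub_eq_zero]
  apply quadratic_eq_zero
  · exact hhom.sub (sumSq_isHomogeneous.C_mul A)
  · intro σ
    rw [map_sub, map_mul, rename_C, rename_sumSq, hsymm]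
  · intro i d hd
    apply coeff_eq_zero_of_odd i _ _ d hd
    rw [map_sub, map_mul, MvPolynomial.aeval_C, aeval_neg_sumSq, heven, algebraMap_eq]
  · rw [coeff_sub, coeff_C_mul, coeff_sumSq_single, hA, mul_one, sub_self]

/-! ### Invariant quartics -/

/-- An invariant homogeneous quartic with vanishing `x₀⁴`- and `x₀²x₁²`-coefficients is zero. -/
theorem quartic_eq_zero (R : MvPolynomial (Fin 3) ℝ) (hhom : R.IsHomogeneous 4)
    (hsymm : ∀ σ : Equiv.Perm (Fin 3), rename σ R = R)
    (heven : ∀ (i : Fin 3) (d : Fin 3 →₀ ℕ), Odd (d i) → coeff d R = 0)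
    (h400 : coeff (Finsupp.single 0 4) R = 0)
    (h220 : coeff (Finsupp.single 0 2 + Finsupp.single 1 2) R = 0) : R = 0 := by
  have h040 : coeff (Finsupp.single 1 4) R = 0 := by
    have := coeff_mapDomain_perm hsymm (Equiv.swap 0 1) (Finsupp.single 0 4)
    rw [Finsupp.mapDomain_single, Equiv.swap_apply_left] at this
    rw [this, h400]
  have h004 : coeff (Finsupp.single 2 4) R = 0 := by
    have := coeff_mapDomain_perm hsymm (Equiv.swap 0 2) (Finsupp.single 0 4)
    rw [Finsupp.mapDomain_single, Equiv.swap_apply_left] at this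
    rw [this, h400]
  have h202 : coeff (Finsupp.single 0 2 + Finsupp.single 2 2) R = 0 := by
    have := coeff_mapDomain_perm hsymm (Equiv.swap 1 2) (Finsupp.single 0 2 + Finsupp.single 1 2)
    rw [Finsupp.mapDomain_add, Finsupp.mapDomain_single, Finsupp.mapDomain_single,
      Equiv.swap_apply_of_ne_of_ne (by decide) (by decide), Equiv.swap_apply_left] at this
    rw [this, h220]
  have h022 : coeff (Finsupp.single 1 2 + Finsupp.single 2 2) R = 0 := by
    have := coeff_mapDomain_perm hsymm (Equiv.swap 0 2) (Finsupp.single 0 2 + Finsupp.single 1 2)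
    rw [Finsupp.mapDomain_add, Finsupp.mapDomain_single, Finsupp.mapDomain_single,
      Equiv.swap_apply_left, Equiv.swap_apply_of_ne_of_ne (by decide) (by decide), add_comm] at this
    rw [this, h220]
  ext d
  rw [coeff_zero]
  obtain ⟨a, b, c, rfl⟩ : ∃ a b c : ℕ,
      d = Finsupp.single 0 a + Finsupp.single 1 b + Finsupp.single 2 c :=
    ⟨d 0, d 1, d 2, finsupp_fin3_eq d⟩
  by_cases hdeg : a + b + c = 4
  · have ha : a ≤ 4 := by omega
    have hb : b ≤ 4 := by omega
    have hc : c ≤ 4 := by omega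
    interval_cases a <;> interval_cases b <;> interval_cases c <;>
      (try simp only [Finsupp.single_zero, add_zero, zero_add]) <;>
      first
        | (exfalso; omega)
        | assumption
        | (apply heven 0; simp only [Finsupp.coe_add, Pi.add_apply, Finsupp.single_apply]; decide)
        | (apply heven 1; simp only [Finsupp.coe_add, Pi.add_apply, Finsupp.single_apply]; decide)
  · exact hhom.coeff_eq_zero (by rw [degree_fin3]; exact hdeg)

/-- `Σ xᵢ⁴` is permutation invariant. -/
theorem rename_sumFourth (σ : Equiv.Perm (Fin 3)) :
    rename σ ((X 0 : MvPolynomial (Fin 3) ℝ) ^ 4 + X 1 ^ 4 + X 2 ^ 4)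
      = (X 0 : MvPolynomial (Fin 3) ℝ) ^ 4 + X 1 ^ 4 + X 2 ^ 4 := by
  have h : ((X 0 : MvPolynomial (Fin 3) ℝ) ^ 4 + X 1 ^ 4 + X 2 ^ 4) = ∑ i : Fin 3, X i ^ 4 := by
    simp [Fin.sum_univ_three]
  rw [h, map_sum]
  simp only [map_pow, rename_X]
  exact Equiv.sum_comp σ (fun i => (X i : MvPolynomial (Fin 3) ℝ) ^ 4)

/-- `Σ_{i<j} xᵢ²xⱼ²` is permutation invariant (via `2 e₂ = (x·x)² - Σ xᵢ⁴`). -/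
theorem rename_eTwo (σ : Equiv.Perm (Fin 3)) :
    rename σ ((X 0 : MvPolynomial (Fin 3) ℝ) ^ 2 * X 1 ^ 2 + X 0 ^ 2 * X 2 ^ 2 + X 1 ^ 2 * X 2 ^ 2)
      = (X 0 : MvPolynomial (Fin 3) ℝ) ^ 2 * X 1 ^ 2 + X 0 ^ 2 * X 2 ^ 2 + X 1 ^ 2 * X 2 ^ 2 := by
  have h : MvPolynomial.C (2 : ℝ) * ((X 0 : MvPolynomial (Fin 3) ℝ) ^ 2 * X 1 ^ 2
      + X 0 ^ 2 * X 2 ^ 2 + X 1 ^ 2 * X 2 ^ 2)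
      = ((X 0 : MvPolynomial (Fin 3) ℝ) ^ 2 + X 1 ^ 2 + X 2 ^ 2) ^ 2
        - ((X 0 : MvPolynomial (Fin 3) ℝ) ^ 4 + X 1 ^ 4 + X 2 ^ 4) := by
    rw [map_ofNat]
    ring
  have h2 := congrArg (rename σ) h
  rw [map_mul, rename_C, map_sub, map_pow, rename_sumSq, rename_sumFourth, ← h] at h2
  exact mul_left_cancel₀ (by simp) h2

/-- Sign changes fix every monomial with even exponents: the squares-built quartics. -/
theorem aeval_neg_quartics (i : Fin 3) :
    MvPolynomial.aeval (fun j : Fin 3 => if j = i then -(X j : MvPolynomial (Fin 3) ℝ) else X j)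
        ((X 0 : MvPolynomial (Fin 3) ℝ) ^ 4 + X 1 ^ 4 + X 2 ^ 4)
        = (X 0 : MvPolynomial (Fin 3) ℝ) ^ 4 + X 1 ^ 4 + X 2 ^ 4 ∧
      MvPolynomial.aeval (fun j : Fin 3 => if j = i then -(X j : MvPolynomial (Fin 3) ℝ) else X j)
        ((X 0 : MvPolynomial (Fin 3) ℝ) ^ 2 * X 1 ^ 2 + X 0 ^ 2 * X 2 ^ 2 + X 1 ^ 2 * X 2 ^ 2)
        = (X 0 : MvPolynomial (Fin 3) ℝ) ^ 2 * X 1 ^ 2 + X 0 ^ 2 * X 2 ^ 2 + X 1 ^ 2 * X 2 ^ 2 := by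
  have key2 : ∀ j : Fin 3,
      (if j = i then -(X j : MvPolynomial (Fin 3) ℝ) else X j) ^ 2 = X j ^ 2 := by
    intro j
    split_ifs <;> ring
  have key4 : ∀ j : Fin 3,
      (if j = i then -(X j : MvPolynomial (Fin 3) ℝ) else X j) ^ 4 = X j ^ 4 := by
    intro j
    split_ifs <;> ring
  constructor
  · simp only [map_add, map_pow, MvPolynomial.aeval_X, key4]
  · simp only [map_add, map_mul, map_pow, MvPolynomial.aeval_X, key2]

/-- Coefficients of the two basic quartics at `x₀⁴` and `x₀²x₁²`. -/
theorem coeff_quartics :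
    coeff (Finsupp.single 0 4) ((X 0 : MvPolynomial (Fin 3) ℝ) ^ 4 + X 1 ^ 4 + X 2 ^ 4) = 1 ∧
    coeff (Finsupp.single 0 4)
      ((X 0 : MvPolynomial (Fin 3) ℝ) ^ 2 * X 1 ^ 2 + X 0 ^ 2 * X 2 ^ 2 + X 1 ^ 2 * X 2 ^ 2) = 0 ∧
    coeff (Finsupp.single 0 2 + Finsupp.single 1 2)
      ((X 0 : MvPolynomial (Fin 3) ℝ) ^ 4 + X 1 ^ 4 + X 2 ^ 4) = 0 ∧
    coeff (Finsupp.single 0 2 + Finsupp.single 1 2)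
      ((X 0 : MvPolynomial (Fin 3) ℝ) ^ 2 * X 1 ^ 2 + X 0 ^ 2 * X 2 ^ 2 + X 1 ^ 2 * X 2 ^ 2) = 1 := by
  have hmul : ∀ j k : Fin 3, (X j : MvPolynomial (Fin 3) ℝ) ^ 2 * X k ^ 2
      = monomial (Finsupp.single j 2 + Finsupp.single k 2) 1 := by
    intro j k
    rw [X_pow_eq_monomial, X_pow_eq_monomial, monomial_mul, one_mul]
  refine ⟨?_, ?_, ?_, ?_⟩ <;>
    simp [coeff_X_pow, hmul, coeff_monomial, finsupp_fin3_eq_iff]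

/-- **Invariant quartics.** A `B₃`-invariant homogeneous quartic is
`A · Σ xᵢ⁴ + B · Σ_{i<j} xᵢ² xⱼ²` with `A`, `B` its `x₀⁴`- and `x₀²x₁²`-coefficients. -/
theorem quartic_eq (Q : MvPolynomial (Fin 3) ℝ) (hhom : Q.IsHomogeneous 4)
    (hsymm : ∀ σ : Equiv.Perm (Fin 3), rename σ Q = Q)
    (heven : ∀ i : Fin 3, MvPolynomial.aeval
      (fun j : Fin 3 => if j = i then -(X j : MvPolynomial (Fin 3) ℝ) else X j) Q = Q) :
    Q = MvPolynomial.C (coeff (Finsupp.single 0 4) Q)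
          * ((X 0 : MvPolynomial (Fin 3) ℝ) ^ 4 + X 1 ^ 4 + X 2 ^ 4)
        + MvPolynomial.C (coeff (Finsupp.single 0 2 + Finsupp.single 1 2) Q)
          * ((X 0 : MvPolynomial (Fin 3) ℝ) ^ 2 * X 1 ^ 2 + X 0 ^ 2 * X 2 ^ 2
              + X 1 ^ 2 * X 2 ^ 2) := by
  set A := coeff (Finsupp.single 0 4) Q with hA
  set B := coeff (Finsupp.single 0 2 + Finsupp.single 1 2) Q with hB
  obtain ⟨c1, c2, c3, c4⟩ := coeff_quartics
  rw [← sub_eq_zero]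
  apply quartic_eq_zero
  · refine hhom.sub (IsHomogeneous.add ?_ ?_)
    · exact (((isHomogeneous_X_pow _ _).add (isHomogeneous_X_pow _ _)).add
        (isHomogeneous_X_pow _ _)).C_mul A
    · refine (IsHomogeneous.add (IsHomogeneous.add ?_ ?_) ?_).C_mul B <;>
        exact (isHomogeneous_X_pow _ _).mul (isHomogeneous_X_pow _ _)
  · intro σ
    rw [map_sub, map_add, map_mul, map_mul, rename_C, rename_C, rename_sumFourth, rename_eTwo,
      hsymm]
  · intro i d hd
    apply coeff_eq_zero_of_odd i _ _ d hd
    obtain ⟨e1, e2⟩ := aeval_neg_quartics i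
    rw [map_sub, map_add, map_mul, map_mul, MvPolynomial.aeval_C, MvPolynomial.aeval_C, e1, e2,
      heven, algebraMap_eq]
  · rw [coeff_sub, coeff_add, coeff_C_mul, coeff_C_mul, c1, c2, ← hA]
    ring
  · rw [coeff_sub, coeff_add, coeff_C_mul, coeff_C_mul, c3, c4, ← hB]
    ring

end Summit.CriticalPhenomena.Ising3DConformalLimit.Theorems.NullConeLocalRigidity

end
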